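import Literature.Claims.NS.Wu2026
import Literature.Analysis.FunctionSpaces.WeakLpQuantitative
import Mathlib.MeasureTheory.Measure.Lebesgue.EqHaar
import HarnessLib

/-!
# C177 `Wu2026` — SALVAGE, TRUE column: (3.18) PROVED — the annular `L^q` bound from the weak
# `L^{9/2}` endpoint (D-0090 NS-CLAIMS, LADDER row rung 3; salvage seat `ns-claims-salvage-p3`)

Kernel proof of the binder `Literature.Claims.NS.Wu2026.Step_318` of `claim_of_steps'` (skeleton
p558978, typist-10 g6), EXACTLY as typed: for a smooth steady flow with `v ∈ L^{9/2,∞}(ℝ³)` and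
`1 < q < 9/2` there is `C_q` with `|v|^q ∈ L¹(A_R)` and `‖v‖_{L^q(A_R)} ≤ C_q R^{−2/3 + 3/q}` for every
`R > 0` — display (3.18) p.10 («‖v‖_{L^q(A_R)} ≤ C_q M R^{−2/3+3/q}, 1 < q < 9/2, R > 0», proof
p.9 l.62 – p.10 l.47 by the layer-cake formula split at one height). Proof here: the tree's
quantitative weak-`L^p` truncation `Literature.Analysis.FunctionSpaces.MemWeakLp.setLIntegral_rpow_le`
(`∫_S |f|^q ≤ |S| λ^q + (q/(p−q)) λ^{q−p} ‖f‖^p_{L^{p,∞}}`, `q < p = 9/2`) on `S = A_R ⊆ B_{2R}`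
(`|A_R| ≤ 8R³|B₁|`, `Measure.addHaar_ball_of_pos`) at the height `λ = R^{−2/3}`: both terms are
multiples of `R^{3 − 2q/3} = (R^{−2/3+3/q})^q`; the constant is
`C_q = (8|B₁| + (q/(9/2 − q)) ‖v‖^{9/2}_{L^{9/2,∞}})^{1/q}` (the print's `C_q M` with the weak norm
absorbed). Standard axioms; no definition. Companion of `SoloSalvageWu2026.lean` (Lemma 3.1) and
`SoloSalvageWu2026Flux.lean` ((3.86), (3.87)).

WHAT THIS IS NOT: not a claim about NS regularity or blow-up; not a claim about any author beyond the
typed locator.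
-/

noncomputable section

set_option linter.dupNamespace false

open MeasureTheory Set Function Filter Topology Metric
open scoped ENNReal NNReal RealInnerProductSpace

namespace Summit.NavierStokesRegularity.NavierStokesRegularity.Theorems.Wu2026Salvage

open Literature.Analysis.FluidPDE Literature.Analysis.FunctionSpaces Literature.Claims.NS.Wu2026

/-- The dyadic annulus sits inside the closed ball of radius `2R`. [cite: Wu2026, A_R p.5 l.58] -/
theorem annulus_subset_closedBall (R : ℝ) : annulus R ⊆ closedBall (0 : E3) (2 * R) := by
  intro x hx
  rw [mem_closedBall_zero_iff]
  exact hx.2.le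

/-- The dyadic annulus sits inside the open ball of radius `2R`. [cite: Wu2026, A_R p.5 l.58] -/
theorem annulus_subset_ball (R : ℝ) : annulus R ⊆ ball (0 : E3) (2 * R) := by
  intro x hx
  rw [mem_ball_zero_iff]
  exact hx.2

/-- `|A_R| ≤ 8R³·|B_1|`. [cite: Wu2026, (3.18) proof p.10 («|A_R| ≃ R³»)] -/
theorem volume_annulus_le {R : ℝ} (hR : 0 < R) :
    volume (annulus R) ≤ ENNReal.ofReal (8 * R ^ 3) * volume (ball (0 : E3) 1) := by
  calc volume (annulus R) ≤ volume (ball (0 : E3) (2 * R)) := measure_mono (annulus_subset_ball R)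
    _ = ENNReal.ofReal ((2 * R) ^ Module.finrank ℝ E3) * volume (ball (0 : E3) 1) :=
        Measure.addHaar_ball_of_pos volume (0 : E3) (by positivity)
    _ = ENNReal.ofReal (8 * R ^ 3) * volume (ball (0 : E3) 1) := by
        rw [finrank_euclideanSpace, Fintype.card_fin]
        ring_nf

/-- **(3.18) PROVED** — the typed binder `Step_318`: for a smooth field `v ∈ L^{9/2,∞}(ℝ³)` and
`1 < q < 9/2`, `‖v‖_{L^q(A_R)} ≤ C_q R^{−2/3 + 3/q}` for all `R > 0` (layer cake split at the height
`λ = R^{−2/3}`: `∫_{A_R}|v|^q ≤ |A_R|λ^q + (q/(9/2−q))λ^{q−9/2}‖v‖^{9/2}_{L^{9/2,∞}}`, tree lemma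
`MemWeakLp.setLIntegral_rpow_le`; both terms are multiples of `R^{3−2q/3}`).
[cite: Wu2026, (3.17)–(3.18) p.9 l.62 – p.10 l.47] -/
theorem step_318 : Step_318 := by
  intro ν hν v p hflow hv q hq1 hq92
  have hq0 : 0 < q := by linarith
  -- the finite constants
  set W : ℝ≥0∞ := eWeakLpPow v ((9 : ℝ≥0∞) / 2) volume with hW
  have hWfin : W < ∞ := hv.2
  have hV1 : volume (ball (0 : E3) 1) < ∞ := measure_ball_lt_top
  have hP : (((9 : ℝ≥0∞) / 2).toReal) = 9 / 2 := by
    rw [ENNReal.toReal_div]; norm_num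
  have hqP : q < ((9 : ℝ≥0∞) / 2).toReal := by rw [hP]; exact hq92
  set K : ℝ := 8 * (volume (ball (0 : E3) 1)).toReal + q / (9 / 2 - q) * W.toReal with hK
  have hK0 : 0 ≤ K := by
    have : 0 ≤ q / (9 / 2 - q) := div_nonneg hq0.le (by linarith)
    positivity
  -- continuity / integrability of `|v|^q`
  have hvc : Continuous v := hflow.smooth_v.continuous
  have hcq : Continuous fun x => ‖v x‖ ^ q :=
    hvc.norm.rpow_const fun _ => Or.inr hq0.le
  refine ⟨K ^ (1 / q), fun R hR => ?_⟩
  have hint : IntegrableOn (fun x => ‖v x‖ ^ q) (annulus R) :=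
    (hcq.continuousOn.integrableOn_compact (isCompact_closedBall (0 : E3) (2 * R))).mono_set
      (annulus_subset_closedBall R)
  refine ⟨hint, ?_⟩
  -- the weak-`L^{9/2}` layer-cake bound at height `λ = R^{-2/3}`
  set lam : ℝ := R ^ (-(2 : ℝ) / 3) with hlam
  have hlam0 : 0 < lam := Real.rpow_pos_of_pos hR _
  have hbound := MemWeakLp.setLIntegral_rpow_le (μ := volume) (p := (9 : ℝ≥0∞) / 2) hv.1 hq0 hqP
    (annulus R) hlam0
  rw [hP, ← hW] at hbound
  have hc0 : 0 ≤ q / (9 / 2 - q) := div_nonneg hq0.le (by linarith)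
  -- identify the powers of `R`
  set a : ℝ := 3 - 2 * q / 3 with ha
  have hRa : 0 < R ^ a := Real.rpow_pos_of_pos hR _
  have hlamq : lam ^ q = R ^ (-(2 : ℝ) / 3 * q) := by
    rw [hlam, ← Real.rpow_mul hR.le]
  have hlamq' : lam ^ (q - 9 / 2) = R ^ a := by
    rw [hlam, ← Real.rpow_mul hR.le, ha]
    congr 1
    ring
  have h8 : 8 * R ^ 3 * R ^ (-(2 : ℝ) / 3 * q) = 8 * R ^ a := by
    have hexp : ((3 : ℕ) : ℝ) + -(2 : ℝ) / 3 * q = a := by rw [ha]; push_cast; ring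
    rw [← Real.rpow_natCast R 3, mul_assoc, ← Real.rpow_add hR, hexp]
  -- the lintegral bound as a multiple of `R^a`
  have hlint : ∫⁻ x in annulus R, ‖v x‖ₑ ^ q ≤ ENNReal.ofReal (K * R ^ a) := by
    refine hbound.trans ?_
    have h1 : volume (annulus R) * ENNReal.ofReal (lam ^ q) ≤
        ENNReal.ofReal (8 * (volume (ball (0 : E3) 1)).toReal * R ^ a) := by
      calc volume (annulus R) * ENNReal.ofReal (lam ^ q)
          ≤ ENNReal.ofReal (8 * R ^ 3) * volume (ball (0 : E3) 1) * ENNReal.ofReal (lam ^ q) :=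
            mul_le_mul' (volume_annulus_le hR) le_rfl
        _ = ENNReal.ofReal (8 * R ^ 3) * ENNReal.ofReal ((volume (ball (0 : E3) 1)).toReal) *
              ENNReal.ofReal (lam ^ q) := by rw [ENNReal.ofReal_toReal hV1.ne]
        _ = ENNReal.ofReal (8 * (volume (ball (0 : E3) 1)).toReal * R ^ a) := by
            rw [← ENNReal.ofReal_mul (by positivity), ← ENNReal.ofReal_mul (by positivity), hlamq]
            congr 1
            calc 8 * R ^ 3 * (volume (ball (0 : E3) 1)).toReal * R ^ (-(2 : ℝ) / 3 * q)
                = (volume (ball (0 : E3) 1)).toReal * (8 * R ^ 3 * R ^ (-(2 : ℝ) / 3 * q)) := by ring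
              _ = (volume (ball (0 : E3) 1)).toReal * (8 * R ^ a) := by rw [h8]
              _ = 8 * (volume (ball (0 : E3) 1)).toReal * R ^ a := by ring
    have h2 : ENNReal.ofReal (q / (9 / 2 - q) * lam ^ (q - 9 / 2)) * W ≤
        ENNReal.ofReal (q / (9 / 2 - q) * W.toReal * R ^ a) := by
      have hnn : 0 ≤ q / (9 / 2 - q) * lam ^ (q - 9 / 2) :=
        mul_nonneg hc0 (Real.rpow_pos_of_pos hlam0 _).le
      apply le_of_eq
      calc ENNReal.ofReal (q / (9 / 2 - q) * lam ^ (q - 9 / 2)) * W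
          = ENNReal.ofReal (q / (9 / 2 - q) * lam ^ (q - 9 / 2)) * ENNReal.ofReal W.toReal := by
            rw [ENNReal.ofReal_toReal hWfin.ne]
        _ = ENNReal.ofReal (q / (9 / 2 - q) * W.toReal * R ^ a) := by
            rw [← ENNReal.ofReal_mul hnn, hlamq']
            congr 1
            ring
    calc volume (annulus R) * ENNReal.ofReal (lam ^ q) +
          ENNReal.ofReal (q / (9 / 2 - q) * lam ^ (q - 9 / 2)) * W
        ≤ ENNReal.ofReal (8 * (volume (ball (0 : E3) 1)).toReal * R ^ a) +
          ENNReal.ofReal (q / (9 / 2 - q) * W.toReal * R ^ a) := add_le_add h1 h2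
      _ = ENNReal.ofReal (K * R ^ a) := by
          rw [← ENNReal.ofReal_add (by positivity) (by positivity), hK]
          ring_nf
  -- pass to the real integral
  have hreal : ∫ x in annulus R, ‖v x‖ ^ q ≤ K * R ^ a := by
    rw [integral_eq_lintegral_of_nonneg_ae (Eventually.of_forall fun x => by positivity)
      hcq.aestronglyMeasurable.restrict]
    have : ∫⁻ x in annulus R, ENNReal.ofReal (‖v x‖ ^ q) = ∫⁻ x in annulus R, ‖v x‖ₑ ^ q := by
      refine lintegral_congr fun x => ?_
      rw [← ofReal_norm, ENNReal.ofReal_rpow_of_nonneg (norm_nonneg _) hq0.le]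
    rw [this]
    exact ENNReal.toReal_le_of_le_ofReal (by positivity) hlint
  -- take the `1/q`-th power
  have hI0 : 0 ≤ ∫ x in annulus R, ‖v x‖ ^ q := integral_nonneg fun x => by positivity
  calc (∫ x in annulus R, ‖v x‖ ^ q) ^ (1 / q) ≤ (K * R ^ a) ^ (1 / q) :=
        Real.rpow_le_rpow hI0 hreal (by positivity)
    _ = K ^ (1 / q) * R ^ (-(2 : ℝ) / 3 + 3 / q) := by
        rw [Real.mul_rpow hK0 hRa.le, ← Real.rpow_mul hR.le, ha]
        congr 2
        field_simp
        ring

end Summit.NavierStokesRegularity.NavierStokesRegularity.Theorems.Wu2026Salvage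

end

-- WHAT THIS IS NOT: not a claim about NS regularity or blow-up; not a claim about any author beyond the typed locator.
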